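import Mathlib
import Summits.NavierStokesRegularity.NavierStokesRegularity.Theorems.SubOnsagerCeilingGapSpec
import Summits.NavierStokesRegularity.NavierStokesRegularity.Theorems.SubOnsagerCeilingGapFamilyKernel
import HarnessLib

/-!
# Topology as a datum: kernel vocabulary and the certificate bridge for `Spec` designs
(helper file for crux stmt-NavierStokesRegularity-27057 `SubOnsagerCeiling.ForwardTailCeilingKP`, `--supports … --as helper`;
LEAD SOC g12, line «kp-shell-barrier», parametric route)

Companion of `SubOnsagerCeilingGapSpec`: for a face specification `s : Spec` the `ArithExpr` forms of its INERTIAL and DAMPING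
conditions (`Spec.eBase`, `Spec.dBase`, built from the shared builders `phiE`, `dampE`, `linE`, `quadE`, `cubGE`, `gradE`, `floorForm`
of `SubOnsagerCeilingGapFamilyKernel`), the eliminated coordinate on the active face (`Spec.qElim`, slot `Spec.sElim`), the face at a
window (`Spec.faceE`); for a design `D : Fin n → Spec` the base slacks `gsBase D` (−face at the window / below / above, canonical
order = window-major); the `eval_*` lemmas tying them to `Spec.face`/`Spec.grad`; and the bridge `inertial_of_cert` (any strictness
bound `−δ`) / `damping_of_cert`: an accepted kernel certificate (`KernelFaceAffine.leafCheckAff`, p699455) on a box gives the REAL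
`hFace` conjuncts of `VirtualFloor.chain_le_of_coupledFaceCertB`. With this pair of files a new TOPOLOGY below `b ≈ 1.43` is a list
literal + certificates + one slice file — no bespoke Lean. HONEST FRAMING: MODEL-lattice plumbing (route SubOnsagerCeiling,
TL-M2Break); nothing here bears on Navier–Stokes regularity; 27057 stays OPEN. [cite: FigueiredoStolfi2004, §3] [cite: Moore1966, §4.4]
-/

noncomputable section

-- the sub-problem namespace `NavierStokesRegularity.NavierStokesRegularity` is the tree's layout (D-0017)
set_option linter.dupNamespace false
-- generated uniform `simp only` lists (one list serves all constructors)
set_option linter.unusedSimpArgs false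

namespace Summit.NavierStokesRegularity.NavierStokesRegularity.Theorems.VirtualFloor.GapSpec

open Literature.Analysis.ValidatedNumerics KernelFaceMul KernelFaceAffine
open Summit.NavierStokesRegularity.NavierStokesRegularity.Theorems.VirtualFloor
open Summit.NavierStokesRegularity.NavierStokesRegularity.Theorems.VirtualFloor.GapRung (pt pt_mem_box9)
open Summit.NavierStokesRegularity.NavierStokesRegularity.Theorems.VirtualFloor.GapFamily (linE monE quadE phiE dampE cubGE gradE
  floorForm slotsX slotsLo slotsUp eval_phiE eval_dampE)

namespace Spec

/-! ## Builders -/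

/-- `c + a0 x_{s0} + a1 x_{s1} + a2 x_{s2} + a3 x_{s3}`. [folklore] -/
def lin4E (c a0 a1 a2 a3 : ℚ) (s : Fin 4 → ℕ) : ArithExpr :=
  .add (linE c a0 a1 a2 (s 0) (s 1) (s 2)) (.mul (.const a3) (.var (s 3)))

/-- Generic base form of a specification against a 4-vector of expressions `W` (`phiE`: inertial; `dampE`: damping). [folklore] -/
def baseForm (W : Fin 4 → ArithExpr) : Spec → ArithExpr
  | cap i _ => W i
  | cub i j κ _ => .sub (.mul (cubGE κ i) (W i)) (W j)
  | plane a0 a1 a2 a3 _ _ => .add (.add (.add (.mul (.const a0) (W 0)) (.mul (.const a1) (W 1))) (.mul (.const a2) (W 2)))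
      (.mul (.const a3) (W 3))
  | quad _ l0 l1 l2 q00 q11 q22 q01 q02 q12 => floorForm (gradE l0 l1 l2 q00 q11 q22 q01 q02 q12) W

/-- The INERTIAL base expression. [folklore] -/
def eBase (s : Spec) : ArithExpr := baseForm phiE s

/-- The DAMPING base expression. [folklore] -/
def dBase (s : Spec) : ArithExpr := baseForm dampE s

/-- The slot eliminated on the active face. [folklore] -/
def sElim : Spec → ℕ
  | cap i _ => i
  | cub _ j _ _ => j
  | plane _ _ _ _ _ e => e
  | quad _ _ _ _ _ _ _ _ _ _ => 3

/-- The eliminated coordinate on the active face as an expression of the others. [folklore] -/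
def qElim : Spec → ArithExpr
  | cap _ c => .const c
  | cub i _ κ ε => .sub (.mul (.const κ) (.mul (.var i) (.mul (.var i) (.var i)))) (.const ε)
  | plane a0 a1 a2 a3 ac e =>
      match e with
      | 0 => lin4E (ac / a0) 0 (-(a1 / a0)) (-(a2 / a0)) (-(a3 / a0)) slotsX
      | 1 => lin4E (ac / a1) (-(a0 / a1)) 0 (-(a2 / a1)) (-(a3 / a1)) slotsX
      | 2 => lin4E (ac / a2) (-(a0 / a2)) (-(a1 / a2)) 0 (-(a3 / a2)) slotsX
      | 3 => lin4E (ac / a3) (-(a0 / a3)) (-(a1 / a3)) (-(a2 / a3)) 0 slotsX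
  | quad c l0 l1 l2 q00 q11 q22 q01 q02 q12 => quadE c l0 l1 l2 q00 q11 q22 q01 q02 q12 0 1 2

/-- The face as an expression at a window occupying the slots `s`. [folklore] -/
def faceE (s : Fin 4 → ℕ) : Spec → ArithExpr
  | cap i c => .sub (.var (s i)) (.const c)
  | cub i j κ ε => .sub (.sub (.mul (.const κ) (.mul (.var (s i)) (.mul (.var (s i)) (.var (s i))))) (.const ε)) (.var (s j))
  | plane a0 a1 a2 a3 ac _ => lin4E (-ac) a0 a1 a2 a3 s
  | quad c l0 l1 l2 q00 q11 q22 q01 q02 q12 => .sub (quadE c l0 l1 l2 q00 q11 q22 q01 q02 q12 (s 0) (s 1) (s 2)) (.var (s 3))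

/-- The four coefficients of a plane as a vector. [folklore] -/
def planeCoeff (a0 a1 a2 a3 : ℚ) : Fin 4 → ℚ := ![a0, a1, a2, a3]

/-- The coefficient solved for on the active face is non-zero (planes only). [folklore] -/
def ElimOK : Spec → Prop
  | plane a0 a1 a2 a3 _ e => planeCoeff a0 a1 a2 a3 e ≠ 0
  | _ => True

end Spec

/-- The base slacks of a design `D : Fin n → Spec`: `−face` at the window, then at the window below, then above. [folklore] -/
def gsBase {n : ℕ} (D : Fin n → Spec) : List ArithExpr :=
  (List.finRange n).map (fun k => .neg ((D k).faceE slotsX)) ++ (List.finRange n).map (fun k => .neg ((D k).faceE slotsLo)) ++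
    (List.finRange n).map (fun k => .neg ((D k).faceE slotsUp))

/-! ## Evaluation lemmas -/

section evals
variable (x : Fin 4 → ℝ) (v z L p b2 : ℝ)

/-- `pt` at a window slot `i < 4` is `x i`. [folklore] -/
theorem pt_fin (i : Fin 4) : pt x v z L p b2 i = x i := by
  fin_cases i <;> rfl

/-- **The generic base form evaluates to the gradient contraction.** [folklore] -/
theorem eval_baseForm (W : Fin 4 → ArithExpr) (w : Fin 4 → ℝ) (hW : ∀ i, (W i).eval (pt x v z L p b2) = w i) (s : Spec) :
    (s.baseForm W).eval (pt x v z L p b2) = s.grad 0 x * w 0 + s.grad 1 x * w 1 + s.grad 2 x * w 2 + s.grad 3 x * w 3 := by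
  have h0 := hW 0; have h1 := hW 1; have h2 := hW 2; have h3 := hW 3
  cases s with
  | cap i c =>
    simp only [Spec.baseForm, Spec.grad_cap]
    fin_cases i <;> simp [h0, h1, h2, h3]
  | cub i j κ ε =>
    simp only [Spec.baseForm, Spec.grad_cub, cubGE, ArithExpr.eval_sub, ArithExpr.eval_mul, ArithExpr.eval_const, ArithExpr.eval_var,
      pt_fin, Rat.cast_mul, Rat.cast_ofNat]
    fin_cases i <;> fin_cases j <;> simp [h0, h1, h2, h3] <;> ring
  | plane a0 a1 a2 a3 ac e =>
    obtain ⟨g0, g1, g2, g3⟩ := Spec.grad_plane x a0 a1 a2 a3 ac e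
    rw [g0, g1, g2, g3]
    simp only [Spec.baseForm, h0, h1, h2, h3, ArithExpr.eval_add, ArithExpr.eval_mul, ArithExpr.eval_const]
  | quad c l0 l1 l2 q00 q11 q22 q01 q02 q12 =>
    obtain ⟨g0, g1, g2, g3⟩ := Spec.grad_quad x c l0 l1 l2 q00 q11 q22 q01 q02 q12
    rw [g0, g1, g2, g3]
    simp only [Spec.baseForm, floorForm, gradE, linE, h0, h1, h2, h3, ArithExpr.eval_add, ArithExpr.eval_sub, ArithExpr.eval_mul,
      ArithExpr.eval_neg, ArithExpr.eval_const, ArithExpr.eval_var, GapRung.pt_0, GapRung.pt_1, GapRung.pt_2, GapRung.pt_3, Rat.cast_mul,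
      Rat.cast_add, Rat.cast_sub, Rat.cast_neg, Rat.cast_div, Rat.cast_ofNat, Rat.cast_one, Rat.cast_zero]
    ring

/-- **The inertial base expression evaluates to the inertial form of the `hFace` hypothesis.** [folklore] -/
theorem eval_eBase (s : Spec) : s.eBase.eval (pt x v z L p b2) =
    s.grad 0 x * (v ^ 2 - p * x 0 * x 1) + s.grad 1 x * (L * (x 0 ^ 2 - p * x 1 * x 2)) +
      s.grad 2 x * (L ^ 2 * (x 1 ^ 2 - p * x 2 * x 3)) + s.grad 3 x * (L ^ 3 * (x 2 ^ 2 - p * x 3 * z)) := by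
  obtain ⟨h0, h1, h2, h3⟩ := eval_phiE x v z L p b2
  exact eval_baseForm x v z L p b2 phiE ![v ^ 2 - p * x 0 * x 1, L * (x 0 ^ 2 - p * x 1 * x 2),
    L ^ 2 * (x 1 ^ 2 - p * x 2 * x 3), L ^ 3 * (x 2 ^ 2 - p * x 3 * z)]
    (fun i => by fin_cases i <;> simp [h0, h1, h2, h3]) s

/-- **The damping base expression evaluates to the damping form of the `hFace` hypothesis.** [folklore] -/
theorem eval_dBase (s : Spec) : s.dBase.eval (pt x v z L p b2) =
    s.grad 0 x * x 0 + s.grad 1 x * (b2 * x 1) + s.grad 2 x * (b2 ^ 2 * x 2) + s.grad 3 x * (b2 ^ 3 * x 3) := by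
  obtain ⟨h0, h1, h2, h3⟩ := eval_dampE x v z L p b2
  exact eval_baseForm x v z L p b2 dampE ![x 0, b2 * x 1, b2 ^ 2 * x 2, b2 ^ 3 * x 3]
    (fun i => by fin_cases i <;> simp [h0, h1, h2, h3]) s

/-- **On the active face the eliminated slot of the point equals the value of `qElim`.** [folklore] -/
theorem pt_sElim_eq (s : Spec) (hs : s.ElimOK) (hk : s.face x = 0) :
    pt x v z L p b2 s.sElim = s.qElim.eval (pt x v z L p b2) := by
  cases s with
  | cap i c =>
    rw [Spec.face_cap] at hk
    simp only [Spec.sElim, Spec.qElim, ArithExpr.eval_const, pt_fin]; linarith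
  | cub i j κ ε =>
    rw [Spec.face_cub] at hk
    simp only [Spec.sElim, Spec.qElim, ArithExpr.eval_sub, ArithExpr.eval_mul, ArithExpr.eval_const, ArithExpr.eval_var, pt_fin]
    linarith
  | plane a0 a1 a2 a3 ac e =>
    rw [Spec.face_plane] at hk
    fin_cases e
    · have hq : a0 ≠ 0 := by simpa [Spec.ElimOK, Spec.planeCoeff] using hs
      have ha : (a0 : ℝ) ≠ 0 := by exact_mod_cast hq
      simp only [Spec.sElim, Spec.qElim, Spec.lin4E, linE, slotsX, ArithExpr.eval_add, ArithExpr.eval_sub, ArithExpr.eval_mul,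
        ArithExpr.eval_neg, ArithExpr.eval_const, ArithExpr.eval_var, GapRung.pt_0, GapRung.pt_1, GapRung.pt_2, GapRung.pt_3,
        Rat.cast_mul, Rat.cast_add, Rat.cast_sub, Rat.cast_neg, Rat.cast_div, Rat.cast_ofNat, Rat.cast_one, Rat.cast_zero, Fin.zero_eta,
        Fin.isValue]
      rw [show x 0 = ((ac : ℝ) - a1 * x 1 - a2 * x 2 - a3 * x 3) / a0 by rw [eq_div_iff ha]; linarith]; ring
    · have hq : a1 ≠ 0 := by simpa [Spec.ElimOK, Spec.planeCoeff] using hs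
      have ha : (a1 : ℝ) ≠ 0 := by exact_mod_cast hq
      simp only [Spec.sElim, Spec.qElim, Spec.lin4E, linE, slotsX, ArithExpr.eval_add, ArithExpr.eval_sub, ArithExpr.eval_mul,
        ArithExpr.eval_neg, ArithExpr.eval_const, ArithExpr.eval_var, GapRung.pt_0, GapRung.pt_1, GapRung.pt_2, GapRung.pt_3,
        Rat.cast_mul, Rat.cast_add, Rat.cast_sub, Rat.cast_neg, Rat.cast_div, Rat.cast_ofNat, Rat.cast_one, Rat.cast_zero, Fin.mk_one,
        Fin.isValue]
      rw [show x 1 = ((ac : ℝ) - a0 * x 0 - a2 * x 2 - a3 * x 3) / a1 by rw [eq_div_iff ha]; linarith]; ring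
    · have hq : a2 ≠ 0 := by simpa [Spec.ElimOK, Spec.planeCoeff] using hs
      have ha : (a2 : ℝ) ≠ 0 := by exact_mod_cast hq
      simp only [Spec.sElim, Spec.qElim, Spec.lin4E, linE, slotsX, ArithExpr.eval_add, ArithExpr.eval_sub, ArithExpr.eval_mul,
        ArithExpr.eval_neg, ArithExpr.eval_const, ArithExpr.eval_var, GapRung.pt_0, GapRung.pt_1, GapRung.pt_2, GapRung.pt_3,
        Rat.cast_mul, Rat.cast_add, Rat.cast_sub, Rat.cast_neg, Rat.cast_div, Rat.cast_ofNat, Rat.cast_one, Rat.cast_zero, Fin.reduceFinMk,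
        Fin.isValue]
      rw [show x 2 = ((ac : ℝ) - a0 * x 0 - a1 * x 1 - a3 * x 3) / a2 by rw [eq_div_iff ha]; linarith]; ring
    · have hq : a3 ≠ 0 := by simpa [Spec.ElimOK, Spec.planeCoeff] using hs
      have ha : (a3 : ℝ) ≠ 0 := by exact_mod_cast hq
      simp only [Spec.sElim, Spec.qElim, Spec.lin4E, linE, slotsX, ArithExpr.eval_add, ArithExpr.eval_sub, ArithExpr.eval_mul,
        ArithExpr.eval_neg, ArithExpr.eval_const, ArithExpr.eval_var, GapRung.pt_0, GapRung.pt_1, GapRung.pt_2, GapRung.pt_3,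
        Rat.cast_mul, Rat.cast_add, Rat.cast_sub, Rat.cast_neg, Rat.cast_div, Rat.cast_ofNat, Rat.cast_one, Rat.cast_zero, Fin.reduceFinMk,
        Fin.isValue]
      rw [show x 3 = ((ac : ℝ) - a0 * x 0 - a1 * x 1 - a2 * x 2) / a3 by rw [eq_div_iff ha]; linarith]; ring
  | quad c l0 l1 l2 q00 q11 q22 q01 q02 q12 =>
    rw [Spec.face_quad] at hk
    simp only [Spec.sElim, Spec.qElim, linE, quadE, monE, ArithExpr.eval_add, ArithExpr.eval_sub, ArithExpr.eval_mul,
      ArithExpr.eval_neg, ArithExpr.eval_const, ArithExpr.eval_var, GapRung.pt_0, GapRung.pt_1, GapRung.pt_2, GapRung.pt_3,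
      Rat.cast_mul, Rat.cast_add, Rat.cast_sub, Rat.cast_neg, Rat.cast_div, Rat.cast_ofNat, Rat.cast_one, Rat.cast_zero]
    linarith

/-- The face expression at the slots `s` evaluates to the face at the window read off those slots. [folklore] -/
theorem eval_faceE (y : ℕ → ℝ) (sl : Fin 4 → ℕ) (s : Spec) :
    (s.faceE sl).eval y = s.face (vec4 (y (sl 0)) (y (sl 1)) (y (sl 2)) (y (sl 3))) := by
  cases s with
  | cap i c =>
    rw [Spec.face_cap]
    fin_cases i <;> simp [Spec.faceE, ArithExpr.eval_sub, ArithExpr.eval_var, ArithExpr.eval_const]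
  | cub i j κ ε =>
    rw [Spec.face_cub]
    fin_cases i <;> fin_cases j <;>
      simp [Spec.faceE, ArithExpr.eval_sub, ArithExpr.eval_mul, ArithExpr.eval_var, ArithExpr.eval_const] <;> (try ring) <;> (try simp)
  | plane a0 a1 a2 a3 ac e =>
    rw [Spec.face_plane]
    simp only [Spec.faceE, Spec.lin4E, linE, ArithExpr.eval_add, ArithExpr.eval_sub, ArithExpr.eval_mul, ArithExpr.eval_neg,
      ArithExpr.eval_const, ArithExpr.eval_var, Rat.cast_mul, Rat.cast_add, Rat.cast_sub, Rat.cast_neg, Rat.cast_div, Rat.cast_ofNat,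
      Rat.cast_one, Rat.cast_zero, vec4_zero, vec4_one, vec4_two, vec4_three]
    ring
  | quad c l0 l1 l2 q00 q11 q22 q01 q02 q12 =>
    rw [Spec.face_quad]
    simp only [Spec.faceE, linE, quadE, monE, ArithExpr.eval_add, ArithExpr.eval_sub, ArithExpr.eval_mul, ArithExpr.eval_neg,
      ArithExpr.eval_const, ArithExpr.eval_var, Rat.cast_mul, Rat.cast_add, Rat.cast_sub, Rat.cast_neg, Rat.cast_div, Rat.cast_ofNat,
      Rat.cast_one, Rat.cast_zero, vec4_zero, vec4_one, vec4_two, vec4_three]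
    ring

/-- **The base slacks are non-negative when the three windows lie in `Ω`.** [folklore] -/
theorem gsBase_nonneg {n : ℕ} (D : Fin n → Spec) (hX : ∀ j, (D j).face x ≤ 0)
    (hLo : ∀ j, (D j).face (vec4 v (x 0) (x 1) (x 2)) ≤ 0) (hUp : ∀ j, (D j).face (vec4 (x 1) (x 2) (x 3) z) ≤ 0) :
    ∀ g ∈ gsBase D, 0 ≤ g.eval (pt x v z L p b2) := by
  intro g hg
  simp only [gsBase, List.mem_append, List.mem_map, List.mem_finRange, true_and] at hg
  have hx4 : vec4 (x 0) (x 1) (x 2) (x 3) = x := by funext i; fin_cases i <;> rfl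
  rcases hg with (⟨j, rfl⟩ | ⟨j, rfl⟩) | ⟨j, rfl⟩
  · rw [ArithExpr.eval_neg, eval_faceE]
    have e : vec4 (pt x v z L p b2 (slotsX 0)) (pt x v z L p b2 (slotsX 1)) (pt x v z L p b2 (slotsX 2))
        (pt x v z L p b2 (slotsX 3)) = x := hx4
    rw [e]; linarith [hX j]
  · rw [ArithExpr.eval_neg, eval_faceE]
    have e : vec4 (pt x v z L p b2 (slotsLo 0)) (pt x v z L p b2 (slotsLo 1)) (pt x v z L p b2 (slotsLo 2))
        (pt x v z L p b2 (slotsLo 3)) = vec4 v (x 0) (x 1) (x 2) := rfl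
    rw [e]; linarith [hLo j]
  · rw [ArithExpr.eval_neg, eval_faceE]
    have e : vec4 (pt x v z L p b2 (slotsUp 0)) (pt x v z L p b2 (slotsUp 1)) (pt x v z L p b2 (slotsUp 2))
        (pt x v z L p b2 (slotsUp 3)) = vec4 (x 1) (x 2) (x 3) z := rfl
    rw [e]; linarith [hUp j]

/-- The slot eliminated by a specification is a window slot. [folklore] -/
theorem sElim_lt (s : Spec) : s.sElim < 4 := by
  cases s with
  | cap i c => exact i.isLt
  | cub i j κ ε => exact j.isLt
  | plane a0 a1 a2 a3 ac e => exact e.isLt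
  | quad => simp [Spec.sElim]

/-- The two EXTRA slacks `qElim ≥ 0`, `49/50 − qElim ≥ 0` hold on the active face. [folklore] -/
theorem extra_nonneg (s : Spec) (hs : s.ElimOK) (hk : s.face x = 0) (h0 : ∀ i, 0 ≤ x i) (hc : ∀ i, x i ≤ (49 / 50 : ℝ)) :
    ∀ g ∈ [s.qElim, .sub (.const (49 / 50)) s.qElim], 0 ≤ g.eval (pt x v z L p b2) := by
  have hq := pt_sElim_eq x v z L p b2 s hs hk
  have hval : pt x v z L p b2 s.sElim = x ⟨s.sElim, sElim_lt s⟩ := pt_fin x v z L p b2 ⟨s.sElim, sElim_lt s⟩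
  have hlo : 0 ≤ pt x v z L p b2 s.sElim := by rw [hval]; exact h0 _
  have hhi : pt x v z L p b2 s.sElim ≤ 49 / 50 := by rw [hval]; exact hc _
  intro g hg
  simp only [List.mem_cons, List.mem_nil_iff, or_false] at hg
  rcases hg with rfl | rfl
  · rw [← hq]; exact hlo
  · simp only [ArithExpr.eval_sub, ArithExpr.eval_const]; rw [← hq]; push_cast; linarith

end evals

/-! ## The certificate bridge -/

/-- **Inertial face condition from a kernel certificate with bound `−δ`** (any design `D : Fin n → Spec`, any rational `δ > 0`).
[cite: FigueiredoStolfi2004, §3] -/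
theorem inertial_of_cert {n : ℕ} {D : Fin n → Spec} {k : Fin n} (hs : (D k).ElimOK) {t : KdCert LeafMul} {B : Box} {δ : ℚ}
    (hcert : t.check (leafCheckAff (substVar (D k).sElim (D k).qElim (D k).eBase)
      ((gsBase D).map (substVar (D k).sElim (D k).qElim) ++ [(D k).qElim, .sub (.const (49 / 50)) (D k).qElim]) (-δ)) B = true)
    (hδ : 0 < δ)
    {x : Fin 4 → ℝ} {v z L p b2 : ℝ} (hmem : Box.mem B (pt x v z L p b2))
    (h0 : ∀ i, 0 ≤ x i) (hc : ∀ i, x i ≤ (49 / 50 : ℝ))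
    (hX : ∀ j, (D j).face x ≤ 0) (hLo : ∀ j, (D j).face (vec4 v (x 0) (x 1) (x 2)) ≤ 0)
    (hUp : ∀ j, (D j).face (vec4 (x 1) (x 2) (x 3) z) ≤ 0) (hk : (D k).face x = 0) :
    (D k).grad 0 x * (v ^ 2 - p * x 0 * x 1) + (D k).grad 1 x * (L * (x 0 ^ 2 - p * x 1 * x 2)) +
      (D k).grad 2 x * (L ^ 2 * (x 1 ^ 2 - p * x 2 * x 3)) + (D k).grad 3 x * (L ^ 3 * (x 2 ^ 2 - p * x 3 * z)) < 0 := by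
  rw [← eval_eBase x v z L p b2 (D k)]
  exact eval_lt_zero_of_kdCheckAff_subst hδ hcert _ hmem (pt_sElim_eq x v z L p b2 (D k) hs hk)
    (gsBase_nonneg x v z L p b2 D hX hLo hUp) (extra_nonneg x v z L p b2 (D k) hs hk h0 hc)

/-- **Damping sign condition from a kernel certificate** (any design `D : Fin n → Spec`). [cite: FigueiredoStolfi2004, §3] -/
theorem damping_of_cert {n : ℕ} {D : Fin n → Spec} {k : Fin n} (hs : (D k).ElimOK) {t : KdCert LeafMul} {B : Box}
    (hcert : t.check (leafCheckAff (.neg (substVar (D k).sElim (D k).qElim (D k).dBase))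
      ((gsBase D).map (substVar (D k).sElim (D k).qElim) ++ [(D k).qElim, .sub (.const (49 / 50)) (D k).qElim]) 0) B = true)
    {x : Fin 4 → ℝ} {v z L p b2 : ℝ} (hmem : Box.mem B (pt x v z L p b2))
    (h0 : ∀ i, 0 ≤ x i) (hc : ∀ i, x i ≤ (49 / 50 : ℝ))
    (hX : ∀ j, (D j).face x ≤ 0) (hLo : ∀ j, (D j).face (vec4 v (x 0) (x 1) (x 2)) ≤ 0)
    (hUp : ∀ j, (D j).face (vec4 (x 1) (x 2) (x 3) z) ≤ 0) (hk : (D k).face x = 0) :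
    0 ≤ (D k).grad 0 x * x 0 + (D k).grad 1 x * (b2 * x 1) + (D k).grad 2 x * (b2 ^ 2 * x 2) +
      (D k).grad 3 x * (b2 ^ 3 * x 3) := by
  rw [← eval_dBase x v z L p b2 (D k)]
  exact eval_nonneg_of_kdCheckAff_subst hcert _ hmem (pt_sElim_eq x v z L p b2 (D k) hs hk)
    (gsBase_nonneg x v z L p b2 D hX hLo hUp) (extra_nonneg x v z L p b2 (D k) hs hk h0 hc)

end Summit.NavierStokesRegularity.NavierStokesRegularity.Theorems.VirtualFloor.GapSpec

end
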